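import Summits.RiemannHypothesis.RiemannHypothesis.Theorems.TiltedLandingLaw421R3Lens1LinkTol

/-!
# Lens-1 meridian, LOCAL STRUCTURE (W09 · lens-1 g12 · IMAGE «Lens1MeridianLocal» v2 — supersedes v1: (L1) also EXPORTS the
# tangency bound `|X y − Re T| ≤ (Im T − y)/4`, which puts the graph inside `T`'s closed half-disc and is what the germ/lift consume)

Token 172 (`…R3Lens1Meridian`) routes stub 1′ of `trkD_v14qRT` on ⟨27010⟩ through the MERIDIAN `C_T⁺ = {Re φ = 0, Im φ > 0}` of
`φ = f^{(j+1)}/f^{(j)} = phiAt f j` at an upper zero `T` of `f^{(j)}`; its open object (B1) `MeridianTrichotomyLaw` is a level-curve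
continuation statement.  This file PROVES the two LOCAL lemmas continuation starts from (nothing global, no law asserted):
* (L1) `PoleVerticalGraph` / `poleVerticalGraph` — at a SIMPLE zero `T` the meridian near `T` is a vertical graph `x = X y` entering
  `T` from below with `Im φ ≥ 1/(4 (Im T − y))` and `|X y − Re T| ≤ (Im T − y)/4`, unique in its box; no point `≠ T` of `{Re φ = 0}` in
  the closed upper half-box has
  `Im φ ≥ 0`.  Ingredients: (L1a) `pole_expansion` (`φ = 1/(z − T) + Ψ`, `Ψ` bounded + Lipschitz, via `dslope`), (L1b)
  `graph_of_halfSlope` (real implicit-function lemma), real algebra (`halfSlope_row`, `end_signs`, `graph_offset`, `im_lower/upper`).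
* (L2) `RegularArc` / `regularArc` — at a regular point (`φ′ ≠ 0`) the level set `{Re φ = c}` is locally an arc parametrised by `Im φ`
  (inverse function theorem as an `OpenPartialHomeomorph`).
HONEST STATUS.  (B1), (B2) `NoExitOrPartnerLaw θ`, stub 1′ `TopPinningTol (1/10)`, ⟨27010⟩ and RH are OPEN and untouched here; the
global lift («MeridianReach») is NOT here.  Every declaration below is proved; no open `Prop` is asserted. -/
namespace RhW08.Lens1MeridianLocal

open Complex Set Metric Literature.Analysis.Complex RhW08.Lens1ArcSign

/-- (L1) POLE-VERTICAL GRAPH (law-typed; PROVED below as `poleVerticalGraph`). At a SIMPLE zero `T` of `f^{(j)}` in the upper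
half-plane there is `r > 0` and a continuous `X` on `[Im T − r, Im T]` with `X (Im T) = Re T` such that on every row
`Im T − r ≤ y < Im T` the point `⟨X y, y⟩` is the UNIQUE point of `{Re φ = 0}` with `|x − Re T| ≤ r`, it is TANGENT to the
vertical (`|X y − Re T| ≤ (Im T − y)/4`, so it lies in `T`'s closed half-disc), and there `Im φ ≥ 1/(4 (Im T − y)) > 0`; and in the
closed upper half-box every point `≠ T` of `{Re φ = 0}` has `Im φ < 0`.  So locally the meridian `{Re φ = 0, Im φ > 0}` at `T` is
exactly a vertical graph entering `T` from BELOW. -/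
def PoleVerticalGraph : Prop :=
  ∀ (f : ℂ → ℂ) (j : ℕ) (T : ℂ), Differentiable ℂ f → iteratedDeriv j f T = 0 → 0 < T.im → iteratedDeriv (j + 1) f T ≠ 0 →
    ∃ r : ℝ, 0 < r ∧ ∃ X : ℝ → ℝ, ContinuousOn X (Icc (T.im - r) T.im) ∧ X T.im = T.re ∧
      (∀ y : ℝ, T.im - r ≤ y → y < T.im →
        |X y - T.re| ≤ r ∧ |X y - T.re| ≤ (T.im - y) / 4 ∧ (phiAt f j ⟨X y, y⟩).re = 0 ∧
        1 / (4 * (T.im - y)) ≤ (phiAt f j ⟨X y, y⟩).im ∧ ∀ x : ℝ, |x - T.re| ≤ r → (phiAt f j ⟨x, y⟩).re = 0 → x = X y) ∧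
      (∀ x y : ℝ, |x - T.re| ≤ r → T.im ≤ y → y ≤ T.im + r → (⟨x, y⟩ : ℂ) ≠ T → (phiAt f j ⟨x, y⟩).re = 0 →
        (phiAt f j ⟨x, y⟩).im < 0)

/-- (L1a) POLE EXPANSION: at a simple zero `T` of `G = f^{(j)}` (`f` entire) there are `r > 0`, `M ≥ 0` and `Ψ` continuous on
`ball T r` with `‖Ψ‖ ≤ M`, `Ψ` `M`-Lipschitz on the ball, and for every `z ≠ T` in the ball `G z ≠ 0` and `φ z = 1/(z − T) + Ψ z`
(`G = (z − T)·H` with `H = dslope G T` analytic, `H T = G′ T ≠ 0`, `Ψ = H′/H`). -/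
theorem pole_expansion (f : ℂ → ℂ) (j : ℕ) (T : ℂ) (hf : Differentiable ℂ f) (hT : iteratedDeriv j f T = 0)
    (hT' : iteratedDeriv (j + 1) f T ≠ 0) :
    ∃ r M : ℝ, 0 < r ∧ 0 ≤ M ∧ ∃ Ψ : ℂ → ℂ, ContinuousOn Ψ (ball T r) ∧ (∀ z ∈ ball T r, ‖Ψ z‖ ≤ M) ∧
      (∀ z₁ ∈ ball T r, ∀ z₂ ∈ ball T r, ‖Ψ z₁ - Ψ z₂‖ ≤ M * ‖z₁ - z₂‖) ∧
      ∀ z ∈ ball T r, z ≠ T → iteratedDeriv j f z ≠ 0 ∧ phiAt f j z = 1 / (z - T) + Ψ z := by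
  set G := iteratedDeriv j f with hG
  have hGd : Differentiable ℂ G := differentiable_iteratedDeriv_of_entire hf j
  have hGT' : deriv G T ≠ 0 := by rw [hG, ← iteratedDeriv_succ]; exact hT'
  set H := dslope G T with hH
  obtain ⟨p, hp⟩ := hGd.analyticAt T
  have hHa : AnalyticAt ℂ H T := hp.has_fpower_series_dslope_fslope.analyticAt
  have hHT : H T ≠ 0 := by rw [hH, dslope_same]; exact hGT'
  have hfac : ∀ z, G z = (z - T) * H z := fun z => by
    have h := sub_smul_dslope G T z; rw [smul_eq_mul, hT, sub_zero] at h; exact h.symm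
  set Ψ : ℂ → ℂ := fun z => deriv H z / H z with hΨ
  have hΨa : AnalyticAt ℂ Ψ T := hHa.deriv.div hHa hHT
  obtain ⟨r₁, hr₁, hH₁⟩ := hHa.exists_ball_analyticOnNhd
  obtain ⟨r₂, hr₂, hΨ₂⟩ := hΨa.exists_ball_analyticOnNhd
  obtain ⟨r₃, hr₃, hH₃⟩ := Metric.eventually_nhds_iff_ball.mp (hHa.continuousAt.eventually_ne hHT)
  set r₀ := min (min r₁ r₂) r₃ with hr₀def
  have hr₀ : 0 < r₀ := lt_min (lt_min hr₁ hr₂) hr₃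
  have hΨon : AnalyticOnNhd ℂ Ψ (ball T r₀) :=
    hΨ₂.mono (Metric.ball_subset_ball (le_trans (min_le_left _ _) (min_le_right _ _)))
  have hcl : closedBall T (r₀ / 2) ⊆ ball T r₀ := Metric.closedBall_subset_ball (by linarith)
  obtain ⟨M₁, hM₁⟩ := (isCompact_closedBall T (r₀ / 2)).exists_bound_of_continuousOn (hΨon.continuousOn.mono hcl)
  obtain ⟨M₂, hM₂⟩ := (isCompact_closedBall T (r₀ / 2)).exists_bound_of_continuousOn (hΨon.deriv.continuousOn.mono hcl)
  refine ⟨r₀ / 2, max (max M₁ M₂) 0, by linarith, le_max_right _ _, Ψ,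
    hΨon.continuousOn.mono (Metric.ball_subset_closedBall.trans hcl), ?_, ?_, ?_⟩
  · intro z hz
    exact (hM₁ z (Metric.ball_subset_closedBall hz)).trans ((le_max_left _ _).trans (le_max_left _ _))
  · intro z₁ hz₁ z₂ hz₂
    exact Convex.norm_image_sub_le_of_norm_deriv_le (f := Ψ) (s := ball T (r₀ / 2))
      (fun x hx => (hΨon x (hcl (Metric.ball_subset_closedBall hx))).differentiableAt)
      (fun x hx => (hM₂ x (Metric.ball_subset_closedBall hx)).trans ((le_max_right _ _).trans (le_max_left _ _)))
      (convex_ball T (r₀ / 2)) hz₂ hz₁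
  · intro z hz hzT
    have hz₀ : z ∈ ball T r₀ := hcl (Metric.ball_subset_closedBall hz)
    have hHz : H z ≠ 0 := hH₃ z (Metric.ball_subset_ball (min_le_right _ _) hz₀)
    have hzT' : z - T ≠ 0 := sub_ne_zero.mpr hzT
    refine ⟨by rw [hfac z]; exact mul_ne_zero hzT' hHz, ?_⟩
    have hHd : DifferentiableAt ℂ H z :=
      (hH₁ z (Metric.ball_subset_ball (le_trans (min_le_left _ _) (min_le_left _ _)) hz₀)).differentiableAt
    have hGfun : G = fun w => (w - T) * H w := funext hfac
    have hdG : deriv G z = H z + (z - T) * deriv H z := by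
      have h1 : HasDerivAt (fun w : ℂ => (w - T) * H w) (1 * H z + (z - T) * deriv H z) z :=
        ((hasDerivAt_id z).sub_const T).mul hHd.hasDerivAt
      rw [hGfun, h1.deriv, one_mul]
    show deriv G z / G z = 1 / (z - T) + deriv H z / H z
    rw [hdG, hfac z]
    field_simp

/-- (L1b) GRAPH FROM HALF-SLOPE: on the box `|x − a| ≤ ρ`, `|y − q| ≤ ρ`, if every row `F · y` gains at least half the run
(`(x₂ − x₁)/2 ≤ F x₂ y − F x₁ y`), is continuous, negative at `a − ρ` and positive at `a + ρ`, and every column `F x ·` is continuous on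
the `y`-interval, then the zero set of `F` in the box is the graph of a function `X` of `y`, continuous on `[q − ρ, q + ρ]`. -/
theorem graph_of_halfSlope {F : ℝ → ℝ → ℝ} {a q ρ : ℝ} (hρ : 0 < ρ)
    (hmono : ∀ y, |y - q| ≤ ρ → ∀ x₁ x₂, |x₁ - a| ≤ ρ → |x₂ - a| ≤ ρ → x₁ ≤ x₂ → (x₂ - x₁) / 2 ≤ F x₂ y - F x₁ y)
    (hneg : ∀ y, |y - q| ≤ ρ → F (a - ρ) y < 0) (hpos : ∀ y, |y - q| ≤ ρ → 0 < F (a + ρ) y)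
    (hcx : ∀ y, |y - q| ≤ ρ → ContinuousOn (fun x => F x y) (Icc (a - ρ) (a + ρ)))
    (hcy : ∀ x y, |x - a| ≤ ρ → |y - q| ≤ ρ → ContinuousWithinAt (fun y' => F x y') (Icc (q - ρ) (q + ρ)) y) :
    ∃ X : ℝ → ℝ, ContinuousOn X (Icc (q - ρ) (q + ρ)) ∧
      ∀ y, |y - q| ≤ ρ → |X y - a| ≤ ρ ∧ F (X y) y = 0 ∧ ∀ x, |x - a| ≤ ρ → F x y = 0 → x = X y := by
  have hbox : ∀ {x : ℝ}, x ∈ Icc (a - ρ) (a + ρ) ↔ |x - a| ≤ ρ := fun {x} => by rw [mem_Icc, abs_le]; constructor <;> intro h <;> constructor <;> linarith [h.1, h.2]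
  have hex : ∀ y, |y - q| ≤ ρ → ∃ x, |x - a| ≤ ρ ∧ F x y = 0 := fun y hy => by
    obtain ⟨x, hx, hx0⟩ := intermediate_value_Icc (by linarith) (hcx y hy) ⟨(hneg y hy).le, (hpos y hy).le⟩
    exact ⟨x, hbox.mp hx, hx0⟩
  have huniq : ∀ y, |y - q| ≤ ρ → ∀ x x', |x - a| ≤ ρ → |x' - a| ≤ ρ → F x y = 0 → F x' y = 0 → x = x' := by
    intro y hy x x' hx hx' h0 h0'; rcases le_total x x' with h | h
    · have := hmono y hy x x' hx hx' h; linarith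
    · have := hmono y hy x' x hx' hx h; linarith
  classical
  refine ⟨fun y => if hy : |y - q| ≤ ρ then Classical.choose (hex y hy) else a, ?_, fun y hy => ?_⟩
  · rw [Metric.continuousOn_iff]
    intro y₁ hy₁ ε hε
    have hy₁' : |y₁ - q| ≤ ρ := by rw [mem_Icc] at hy₁; rw [abs_le]; constructor <;> linarith [hy₁.1, hy₁.2]
    obtain ⟨hx₁, hF₁⟩ := Classical.choose_spec (hex y₁ hy₁')
    set x₁ := Classical.choose (hex y₁ hy₁') with hx₁def
    obtain ⟨δ, hδ, hδε⟩ := Metric.continuousWithinAt_iff.mp (hcy x₁ y₁ hx₁ hy₁') (ε / 2) (by linarith)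
    refine ⟨δ, hδ, fun y₂ hy₂ hd => ?_⟩
    have hy₂' : |y₂ - q| ≤ ρ := by rw [mem_Icc] at hy₂; rw [abs_le]; constructor <;> linarith [hy₂.1, hy₂.2]
    obtain ⟨hx₂, hF₂⟩ := Classical.choose_spec (hex y₂ hy₂')
    set x₂ := Classical.choose (hex y₂ hy₂') with hx₂def
    have hsmall : |F x₁ y₂| < ε / 2 := by
      have h := hδε hy₂ hd; rw [Real.dist_eq, hF₁, sub_zero] at h; exact h
    simp only [dif_pos hy₁', dif_pos hy₂']
    rw [Real.dist_eq]
    rcases le_total x₁ x₂ with h | h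
    · have h1 := hmono y₂ hy₂' x₁ x₂ hx₁ hx₂ h
      rw [hF₂] at h1; rw [abs_of_nonneg (by linarith)]; linarith [(abs_lt.mp hsmall).1]
    · have h1 := hmono y₂ hy₂' x₂ x₁ hx₂ hx₁ h
      rw [hF₂] at h1; rw [abs_of_nonpos (by linarith)]; linarith [(abs_lt.mp hsmall).2]
  · obtain ⟨hx, hF⟩ := Classical.choose_spec (hex y hy)
    simp only [dif_pos hy]
    exact ⟨hx, hF, fun x hx' hF' => huniq y hy x _ hx' hx hF' hF⟩

/-- real/imaginary parts of `φ = 1/(z−T) + Ψ` cleared of the denominator `|z − T|²`. -/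
theorem re_im_of_pole {z T Ψz φz : ℂ} (hzT : z ≠ T) (h : φz = 1 / (z - T) + Ψz) :
    φz.re * normSq (z - T) = (z - T).re + normSq (z - T) * Ψz.re ∧
      φz.im * normSq (z - T) = -(z - T).im + normSq (z - T) * Ψz.im := by
  have hn : normSq (z - T) ≠ 0 := by rw [Ne, Complex.normSq_eq_zero]; exact sub_ne_zero.mpr hzT
  rw [h, Complex.add_re, Complex.add_im, one_div, Complex.inv_re, Complex.inv_im]
  constructor <;> field_simp

/-- the HALF-SLOPE inequality of a row (pure real algebra). -/
theorem halfSlope_row {a q ρ M x₁ x₂ y R₁ R₂ : ℝ} (hρ1 : ρ ≤ 1) (hM : 0 ≤ M) (hρM : ρ * M ≤ 1 / 8)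
    (hx₁ : |x₁ - a| ≤ ρ) (hx₂ : |x₂ - a| ≤ ρ) (hy : |y - q| ≤ ρ) (hx : x₁ ≤ x₂) (hR₂ : |R₂| ≤ M)
    (hd : |R₂ - R₁| ≤ M * (x₂ - x₁)) :
    (x₂ - x₁) / 2 ≤ (x₂ - a + ((x₂ - a) ^ 2 + (y - q) ^ 2) * R₂) - (x₁ - a + ((x₁ - a) ^ 2 + (y - q) ^ 2) * R₁) := by
  have hρ0 : 0 ≤ ρ := (abs_nonneg _).trans hx₁
  have hA : |(((x₂ - a) ^ 2 + (y - q) ^ 2) - ((x₁ - a) ^ 2 + (y - q) ^ 2)) * R₂| ≤ (x₂ - x₁) * (2 * ρ) * M := by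
    rw [abs_mul, show ((x₂ - a) ^ 2 + (y - q) ^ 2) - ((x₁ - a) ^ 2 + (y - q) ^ 2) = (x₂ - x₁) * (x₂ + x₁ - 2 * a) by ring, abs_mul,
      abs_of_nonneg (sub_nonneg.mpr hx)]
    have hs : |x₂ + x₁ - 2 * a| ≤ 2 * ρ := by
      calc |x₂ + x₁ - 2 * a| = |(x₂ - a) + (x₁ - a)| := by ring_nf
        _ ≤ |x₂ - a| + |x₁ - a| := abs_add_le _ _
        _ ≤ 2 * ρ := by linarith
    exact mul_le_mul (mul_le_mul_of_nonneg_left hs (sub_nonneg.mpr hx)) hR₂ (abs_nonneg _) (by positivity)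
  have hn₁ : (x₁ - a) ^ 2 + (y - q) ^ 2 ≤ 2 * ρ ^ 2 := by
    nlinarith [abs_le.mp hx₁, abs_le.mp hy, sq_abs (x₁ - a), sq_abs (y - q), abs_nonneg (x₁ - a), abs_nonneg (y - q)]
  have hB : |((x₁ - a) ^ 2 + (y - q) ^ 2) * (R₂ - R₁)| ≤ 2 * ρ ^ 2 * (M * (x₂ - x₁)) := by
    rw [abs_mul, abs_of_nonneg (by positivity)]
    exact mul_le_mul hn₁ hd (abs_nonneg _) (by positivity)
  have hsplit : ((x₂ - a) ^ 2 + (y - q) ^ 2) * R₂ - ((x₁ - a) ^ 2 + (y - q) ^ 2) * R₁ =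
      (((x₂ - a) ^ 2 + (y - q) ^ 2) - ((x₁ - a) ^ 2 + (y - q) ^ 2)) * R₂ + ((x₁ - a) ^ 2 + (y - q) ^ 2) * (R₂ - R₁) := by ring
  have hcoef : (x₂ - x₁) * (2 * ρ) * M + 2 * ρ ^ 2 * (M * (x₂ - x₁)) ≤ (x₂ - x₁) / 2 := by
    have k1 : (x₂ - x₁) * (ρ * M) ≤ (x₂ - x₁) * (1 / 8) := mul_le_mul_of_nonneg_left hρM (sub_nonneg.mpr hx)
    have k2 : (x₂ - x₁) * (ρ * M) * ρ ≤ (x₂ - x₁) * (ρ * M) * 1 :=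
      mul_le_mul_of_nonneg_left hρ1 (mul_nonneg (sub_nonneg.mpr hx) (mul_nonneg hρ0 hM))
    nlinarith [k1, k2, sub_nonneg.mpr hx]
  linarith [neg_abs_le ((((x₂ - a) ^ 2 + (y - q) ^ 2) - ((x₁ - a) ^ 2 + (y - q) ^ 2)) * R₂), neg_abs_le (((x₁ - a) ^ 2 + (y - q) ^ 2) * (R₂ - R₁))]

/-- signs of `F` on the vertical sides of the box. -/
theorem end_signs {q ρ M y R : ℝ} (hρ : 0 < ρ) (hρM : ρ * M ≤ 1 / 8) (hy : |y - q| ≤ ρ) (hR : |R| ≤ M) :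
    0 < ρ + (ρ ^ 2 + (y - q) ^ 2) * R ∧ -ρ + ((-ρ) ^ 2 + (y - q) ^ 2) * R < 0 := by
  have hn : ρ ^ 2 + (y - q) ^ 2 ≤ 2 * ρ ^ 2 := by nlinarith [abs_le.mp hy]
  have h1 : |(ρ ^ 2 + (y - q) ^ 2) * R| ≤ 2 * ρ ^ 2 * M := by
    rw [abs_mul, abs_of_nonneg (by positivity)]; exact mul_le_mul hn hR (abs_nonneg _) (by positivity)
  have h4 : 2 * ρ ^ 2 * M ≤ ρ / 4 := by nlinarith
  rw [neg_sq]; constructor <;> linarith [neg_abs_le ((ρ ^ 2 + (y - q) ^ 2) * R), le_abs_self ((ρ ^ 2 + (y - q) ^ 2) * R)]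

/-- on the graph the horizontal offset is quadratic in the height: `|x − a| ≤ 2 d² M`. -/
theorem graph_offset {a ρ M x d R : ℝ} (hρM : ρ * M ≤ 1 / 8) (hx : |x - a| ≤ ρ) (hR : |R| ≤ M)
    (h0 : x - a + ((x - a) ^ 2 + d ^ 2) * R = 0) : |x - a| ≤ 2 * d ^ 2 * M := by
  have hρ0 : 0 ≤ ρ := (abs_nonneg _).trans hx
  have e : ((x - a) ^ 2 + d ^ 2) * R = -(x - a) := by linarith
  have h1 : |x - a| = ((x - a) ^ 2 + d ^ 2) * |R| := by
    calc |x - a| = |-(((x - a) ^ 2 + d ^ 2) * R)| := by rw [e, neg_neg]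
      _ = ((x - a) ^ 2 + d ^ 2) * |R| := by rw [abs_neg, abs_mul, abs_of_nonneg (by positivity)]
  have h2 : (x - a) ^ 2 ≤ ρ * |x - a| := by rw [← sq_abs]; nlinarith [abs_nonneg (x - a)]
  have h3 : |x - a| ≤ (ρ * |x - a| + d ^ 2) * M :=
    calc |x - a| = ((x - a) ^ 2 + d ^ 2) * |R| := h1
      _ ≤ (ρ * |x - a| + d ^ 2) * M :=
        mul_le_mul (by linarith) hR (abs_nonneg _) (add_nonneg (mul_nonneg hρ0 (abs_nonneg _)) (sq_nonneg d))
  have h4 : ρ * M * |x - a| ≤ 1 / 8 * |x - a| := mul_le_mul_of_nonneg_right hρM (abs_nonneg _)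
  nlinarith [abs_nonneg (x - a), mul_nonneg (sq_nonneg d) ((abs_nonneg R).trans hR), h3, h4]

/-- `Im φ ≥ 1/(4d)` below the pole on the graph. -/
theorem im_lower {a M x d I : ℝ} (hd : 0 < d) (hdM : d * M ≤ 1 / 8) (hx : |x - a| ≤ 2 * d ^ 2 * M)
    (hI : -M ≤ I) : 1 / (4 * d) ≤ (d + ((x - a) ^ 2 + d ^ 2) * I) / ((x - a) ^ 2 + d ^ 2) := by
  have hn0 : 0 < (x - a) ^ 2 + d ^ 2 := by positivity
  have hxa : (x - a) ^ 2 ≤ d ^ 2 / 16 := by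
    have : |x - a| ≤ d / 4 := hx.trans (by nlinarith)
    nlinarith [abs_nonneg (x - a), sq_abs (x - a)]
  rw [div_le_div_iff₀ (by positivity) hn0]
  nlinarith [mul_le_mul_of_nonneg_left hI hn0.le, mul_le_mul_of_nonneg_left hdM hn0.le, sq_nonneg (x - a)]

/-- `Im φ < 0` above the pole on the level set. -/
theorem im_upper {a M x d I : ℝ} (hd : 0 < d) (hdM : d * M ≤ 1 / 8) (hx : |x - a| ≤ 2 * d ^ 2 * M)
    (hI : I ≤ M) : (-d + ((x - a) ^ 2 + d ^ 2) * I) / ((x - a) ^ 2 + d ^ 2) < 0 := by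
  have hn0 : 0 < (x - a) ^ 2 + d ^ 2 := by positivity
  have hxa : (x - a) ^ 2 ≤ d ^ 2 / 16 := by
    have : |x - a| ≤ d / 4 := hx.trans (by nlinarith)
    nlinarith [abs_nonneg (x - a), sq_abs (x - a)]
  rw [div_neg_iff]; right
  refine ⟨?_, hn0⟩
  nlinarith [mul_le_mul_of_nonneg_left hI hn0.le, mul_le_mul_of_nonneg_left hdM hn0.le, sq_nonneg (x - a)]


/-- (L1) PROVED: the pole-vertical graph law holds. -/
theorem poleVerticalGraph : PoleVerticalGraph := by
  intro f j T hf hT hq hT'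
  obtain ⟨r, M, hr, hM, Ψ, hΨc, hΨb, hΨL, hφ⟩ := pole_expansion f j T hf hT hT'
  set ρ : ℝ := min (r / 4) (1 / (8 * (M + 1))) with hρdef
  have hρ : 0 < ρ := lt_min (by linarith) (by positivity)
  have hρr : ρ ≤ r / 4 := min_le_left _ _
  have hρM1 : ρ * (M + 1) ≤ 1 / 8 := by
    calc ρ * (M + 1) ≤ 1 / (8 * (M + 1)) * (M + 1) := mul_le_mul_of_nonneg_right (min_le_right _ _) (by positivity)
      _ = 1 / 8 := by field_simp
  have hρM : ρ * M ≤ 1 / 8 := by nlinarith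
  have hρ1 : ρ ≤ 1 := by nlinarith
  -- the box `|x − Re T| ≤ ρ, |y − Im T| ≤ ρ` lies in the ball
  have hball : ∀ x y : ℝ, |x - T.re| ≤ ρ → |y - T.im| ≤ ρ → (⟨x, y⟩ : ℂ) ∈ ball T r := by
    intro x y hx hy
    rw [mem_ball, dist_eq_norm]
    calc ‖(⟨x, y⟩ : ℂ) - T‖ ≤ |((⟨x, y⟩ : ℂ) - T).re| + |((⟨x, y⟩ : ℂ) - T).im| := Complex.norm_le_abs_re_add_abs_im _
      _ = |x - T.re| + |y - T.im| := by simp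
      _ < r := by linarith
  have hnormSq : ∀ x y : ℝ, normSq ((⟨x, y⟩ : ℂ) - T) = (x - T.re) ^ 2 + (y - T.im) ^ 2 := by
    intro x y; rw [Complex.normSq_apply]; simp; ring
  have hRe : ∀ x y : ℝ, |x - T.re| ≤ ρ → |y - T.im| ≤ ρ → |(Ψ ⟨x, y⟩).re| ≤ M := fun x y hx hy =>
    (Complex.abs_re_le_norm _).trans (hΨb _ (hball x y hx hy))
  have hIm : ∀ x y : ℝ, |x - T.re| ≤ ρ → |y - T.im| ≤ ρ → |(Ψ ⟨x, y⟩).im| ≤ M := fun x y hx hy =>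
    (Complex.abs_im_le_norm _).trans (hΨb _ (hball x y hx hy))
  -- key identities on the punctured box
  have hkey : ∀ x y : ℝ, |x - T.re| ≤ ρ → |y - T.im| ≤ ρ → (⟨x, y⟩ : ℂ) ≠ T →
      (phiAt f j ⟨x, y⟩).re * ((x - T.re) ^ 2 + (y - T.im) ^ 2) =
        (x - T.re) + ((x - T.re) ^ 2 + (y - T.im) ^ 2) * (Ψ ⟨x, y⟩).re ∧
      (phiAt f j ⟨x, y⟩).im * ((x - T.re) ^ 2 + (y - T.im) ^ 2) =
        (T.im - y) + ((x - T.re) ^ 2 + (y - T.im) ^ 2) * (Ψ ⟨x, y⟩).im := by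
    intro x y hx hy hzT
    obtain ⟨-, hφz⟩ := hφ _ (hball x y hx hy) hzT
    have h := re_im_of_pole hzT hφz
    rw [hnormSq] at h
    refine ⟨?_, ?_⟩
    · rw [h.1]; simp
    · rw [h.2]; simp
  have hnpos : ∀ x y : ℝ, (⟨x, y⟩ : ℂ) ≠ T → 0 < (x - T.re) ^ 2 + (y - T.im) ^ 2 := by
    intro x y hzT; rw [← hnormSq]; exact Complex.normSq_pos.mpr (sub_ne_zero.mpr hzT)
  -- continuity of F on the box
  have hmk : Continuous fun p : ℝ × ℝ => (⟨p.1, p.2⟩ : ℂ) := by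
    have e : (fun p : ℝ × ℝ => (⟨p.1, p.2⟩ : ℂ)) = fun p => (p.1 : ℂ) + (p.2 : ℂ) * I := by
      funext p; exact Complex.mk_eq_add_mul_I p.1 p.2
    rw [e]
    exact (Complex.continuous_ofReal.comp continuous_fst).add ((Complex.continuous_ofReal.comp continuous_snd).mul continuous_const)
  have hFc : ContinuousOn (fun p : ℝ × ℝ => (p.1 - T.re) + ((p.1 - T.re) ^ 2 + (p.2 - T.im) ^ 2) * (Ψ ⟨p.1, p.2⟩).re)
      {p : ℝ × ℝ | |p.1 - T.re| ≤ ρ ∧ |p.2 - T.im| ≤ ρ} := by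
    have hΨp : ContinuousOn (fun p : ℝ × ℝ => Ψ ⟨p.1, p.2⟩) {p : ℝ × ℝ | |p.1 - T.re| ≤ ρ ∧ |p.2 - T.im| ≤ ρ} :=
      hΨc.comp hmk.continuousOn (fun p hp => hball p.1 p.2 hp.1 hp.2)
    exact ((continuous_fst.sub continuous_const).continuousOn).add
      ((((continuous_fst.sub continuous_const).pow 2).add ((continuous_snd.sub continuous_const).pow 2)).continuousOn.mul
        (Complex.continuous_re.comp_continuousOn hΨp))
  have habsIcc : ∀ {c t : ℝ}, t ∈ Icc (c - ρ) (c + ρ) → |t - c| ≤ ρ := fun {c t} ht => by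
    rw [abs_le]; constructor <;> linarith [ht.1, ht.2]
  have hIccabs : ∀ {c t : ℝ}, |t - c| ≤ ρ → t ∈ Icc (c - ρ) (c + ρ) := fun {c t} ht => by
    constructor <;> linarith [(abs_le.mp ht).1, (abs_le.mp ht).2]
  -- the graph
  obtain ⟨X, hXc, hX⟩ := graph_of_halfSlope
    (F := fun x y => (x - T.re) + ((x - T.re) ^ 2 + (y - T.im) ^ 2) * (Ψ ⟨x, y⟩).re) (a := T.re) (q := T.im) hρ
    (by
      intro y hy x₁ x₂ hx₁ hx₂ hx
      have hd : |(Ψ ⟨x₂, y⟩).re - (Ψ ⟨x₁, y⟩).re| ≤ M * (x₂ - x₁) := by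
        have e : (⟨x₂, y⟩ : ℂ) - ⟨x₁, y⟩ = ((x₂ - x₁ : ℝ) : ℂ) := by apply Complex.ext <;> simp
        calc |(Ψ ⟨x₂, y⟩).re - (Ψ ⟨x₁, y⟩).re| = |(Ψ ⟨x₂, y⟩ - Ψ ⟨x₁, y⟩).re| := by rw [Complex.sub_re]
          _ ≤ ‖Ψ ⟨x₂, y⟩ - Ψ ⟨x₁, y⟩‖ := Complex.abs_re_le_norm _
          _ ≤ M * ‖(⟨x₂, y⟩ : ℂ) - ⟨x₁, y⟩‖ := hΨL _ (hball x₂ y hx₂ hy) _ (hball x₁ y hx₁ hy)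
          _ = M * (x₂ - x₁) := by rw [e, Complex.norm_real, Real.norm_eq_abs, abs_of_nonneg (sub_nonneg.mpr hx)]
      exact halfSlope_row hρ1 hM hρM hx₁ hx₂ hy hx (hRe x₂ y hx₂ hy) hd)
    (by
      intro y hy
      have h := (end_signs (R := (Ψ ⟨T.re - ρ, y⟩).re) hρ hρM hy (hRe _ y (by rw [sub_sub_cancel_left, abs_neg, abs_of_pos hρ]) hy)).2
      simpa only [sub_sub_cancel_left] using h)
    (by
      intro y hy
      have h := (end_signs (R := (Ψ ⟨T.re + ρ, y⟩).re) hρ hρM hy (hRe _ y (by rw [add_sub_cancel_left, abs_of_pos hρ]) hy)).1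
      simpa only [add_sub_cancel_left] using h)
    (by
      intro y hy
      have hl : Continuous fun x : ℝ => (x, y) := continuous_id.prodMk continuous_const
      exact hFc.comp hl.continuousOn (fun x hx => ⟨habsIcc hx, hy⟩))
    (by
      intro x y hx hy
      have hl : Continuous fun y' : ℝ => (x, y') := continuous_const.prodMk continuous_id
      exact (hFc.comp hl.continuousOn (fun y' hy' => ⟨hx, habsIcc hy'⟩)).continuousWithinAt (hIccabs hy))
  refine ⟨ρ, hρ, X, hXc.mono (Icc_subset_Icc le_rfl (by linarith)), ?_, ?_, ?_⟩
  · -- X (Im T) = Re T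
    have h0 : |T.im - T.im| ≤ ρ := by rw [sub_self, abs_zero]; exact hρ.le
    have h1 : |T.re - T.re| ≤ ρ := by rw [sub_self, abs_zero]; exact hρ.le
    exact ((hX T.im h0).2.2 T.re h1 (by simp)).symm
  · -- rows below the pole
    intro y hy₁ hy₂
    have hy : |y - T.im| ≤ ρ := by rw [abs_le]; constructor <;> linarith
    obtain ⟨hXρ, hF0, huq⟩ := hX y hy
    have hzT : (⟨X y, y⟩ : ℂ) ≠ T := fun h => by have := congrArg Complex.im h; simp at this; linarith
    have hn := hnpos (X y) y hzT
    obtain ⟨kre, kim⟩ := hkey (X y) y hXρ hy hzT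
    have hd : 0 < T.im - y := by linarith
    have hdM : (T.im - y) * M ≤ 1 / 8 := (mul_le_mul_of_nonneg_right (by linarith [(abs_le.mp hy).1]) hM).trans hρM
    have e2 : (y - T.im) ^ 2 = (T.im - y) ^ 2 := by ring
    have hoff : |X y - T.re| ≤ 2 * (T.im - y) ^ 2 * M :=
      graph_offset hρM hXρ (hRe (X y) y hXρ hy) (by rw [← e2]; exact hF0)
    refine ⟨hXρ, hoff.trans (by nlinarith [hdM, hd]), ?_, ?_, ?_⟩
    · have := kre; rw [hF0] at this
      rcases mul_eq_zero.mp this with h | h; exact h; exact absurd h hn.ne'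
    · have him : (phiAt f j ⟨X y, y⟩).im =
          ((T.im - y) + ((X y - T.re) ^ 2 + (T.im - y) ^ 2) * (Ψ ⟨X y, y⟩).im) / ((X y - T.re) ^ 2 + (T.im - y) ^ 2) := by
        rw [eq_div_iff (by rw [← e2]; exact hn.ne'), ← e2]; exact kim
      rw [him]
      exact im_lower hd hdM hoff (abs_le.mp (hIm (X y) y hXρ hy)).1
    · intro x hx hre
      have hzT' : (⟨x, y⟩ : ℂ) ≠ T := fun h => by have := congrArg Complex.im h; simp at this; linarith
      obtain ⟨kre', -⟩ := hkey x y hx hy hzT'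
      rw [hre, zero_mul] at kre'
      exact huq x hx kre'.symm
  · -- the closed upper half-box carries no point of the level set with `Im φ ≥ 0`
    intro x y hx hy₁ hy₂ hzT hre
    have hy : |y - T.im| ≤ ρ := by rw [abs_le]; constructor <;> linarith
    have hn := hnpos x y hzT
    obtain ⟨kre, kim⟩ := hkey x y hx hy hzT
    rw [hre, zero_mul] at kre
    have hoff : |x - T.re| ≤ 2 * (y - T.im) ^ 2 * M := graph_offset hρM hx (hRe x y hx hy) kre.symm
    rcases eq_or_lt_of_le hy₁ with heq | hlt
    · exfalso
      apply hzT
      have hx0 : x = T.re := by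
        have : |x - T.re| ≤ 0 := by rw [← heq, sub_self] at hoff; simpa using hoff
        linarith [abs_nonneg (x - T.re), abs_eq_zero.mp (le_antisymm this (abs_nonneg _))]
      apply Complex.ext <;> simp [hx0, heq]
    · have hd : 0 < y - T.im := by linarith
      have hdM : (y - T.im) * M ≤ 1 / 8 := (mul_le_mul_of_nonneg_right (by linarith [(abs_le.mp hy).2]) hM).trans hρM
      have him : (phiAt f j ⟨x, y⟩).im =
          (-(y - T.im) + ((x - T.re) ^ 2 + (y - T.im) ^ 2) * (Ψ ⟨x, y⟩).im) / ((x - T.re) ^ 2 + (y - T.im) ^ 2) := by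
        rw [eq_div_iff hn.ne', neg_sub]; exact kim
      rw [him]
      exact im_upper hd hdM hoff (abs_le.mp (hIm x y hx hy)).2

/-- (L2) REGULAR ARC (law-typed; PROVED below as `regularArc`): at a point `z₀` where `φ` is holomorphic with `φ′(z₀) ≠ 0` the
level set `{Re φ = Re φ(z₀)}` near `z₀` is the continuous image `Z` of an interval, parametrised by `t = Im φ` itself
(`φ (Z t) = Re φ(z₀) + i t`), and every nearby point of the level set is `Z` of its own `Im φ`. -/
def RegularArc : Prop :=
  ∀ (φ : ℂ → ℂ) (z₀ : ℂ), AnalyticAt ℂ φ z₀ → deriv φ z₀ ≠ 0 →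
    ∃ r ρ : ℝ, 0 < r ∧ 0 < ρ ∧ ∃ Z : ℝ → ℂ, ContinuousOn Z (Ioo ((φ z₀).im - ρ) ((φ z₀).im + ρ)) ∧ Z (φ z₀).im = z₀ ∧
      (∀ t ∈ Ioo ((φ z₀).im - ρ) ((φ z₀).im + ρ), φ (Z t) = ⟨(φ z₀).re, t⟩) ∧
      ∀ z ∈ Metric.ball z₀ r, (φ z).re = (φ z₀).re → |(φ z).im - (φ z₀).im| < ρ ∧ Z (φ z).im = z

/-- (L2) PROVED: the regular-arc law holds (inverse function theorem, `Z t := φ⁻¹_loc ⟨Re φ(z₀), t⟩`). -/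
theorem regularArc : RegularArc := by
  intro φ z₀ hφa hne
  have hS := (hφa.hasStrictDerivAt).hasStrictFDerivAt_equiv hne
  set P := hS.toOpenPartialHomeomorph φ with hPdef
  have hPφ : (P : ℂ → ℂ) = φ := hS.toOpenPartialHomeomorph_coe
  have hz₀ : z₀ ∈ P.source := hS.mem_toOpenPartialHomeomorph_source
  have hw₀ : φ z₀ ∈ P.target := hS.image_mem_toOpenPartialHomeomorph_target
  obtain ⟨ρ, hρ, hball⟩ := Metric.isOpen_iff.mp P.open_target (φ z₀) hw₀
  obtain ⟨r₁, hr₁, hball₁⟩ := Metric.isOpen_iff.mp P.open_source z₀ hz₀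
  obtain ⟨δ, hδ, hδρ⟩ := Metric.continuousAt_iff.mp hφa.continuousAt ρ hρ
  have hline : ∀ t : ℝ, dist (⟨(φ z₀).re, t⟩ : ℂ) (φ z₀) = |t - (φ z₀).im| := fun t => by rw [Complex.dist_of_re_eq (by simp), Real.dist_eq]
  have hmem : ∀ t ∈ Ioo ((φ z₀).im - ρ) ((φ z₀).im + ρ), (⟨(φ z₀).re, t⟩ : ℂ) ∈ P.target := fun t ht =>
    hball (by rw [Metric.mem_ball, hline]; exact abs_sub_lt_iff.mpr ⟨by linarith [ht.2], by linarith [ht.1]⟩)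
  have hl : Continuous fun t : ℝ => (⟨(φ z₀).re, t⟩ : ℂ) := by
    have : (fun t : ℝ => (⟨(φ z₀).re, t⟩ : ℂ)) = fun t : ℝ => ((φ z₀).re : ℂ) + (t : ℂ) * I :=
      funext fun t => Complex.mk_eq_add_mul_I _ t
    rw [this]; exact continuous_const.add (Complex.continuous_ofReal.mul continuous_const)
  refine ⟨min δ r₁, ρ, lt_min hδ hr₁, hρ, fun t => P.symm ⟨(φ z₀).re, t⟩, P.continuousOn_symm.comp hl.continuousOn hmem, ?_, ?_, ?_⟩
  · have h := P.left_inv hz₀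
    rw [hPφ] at h; show P.symm (⟨(φ z₀).re, (φ z₀).im⟩ : ℂ) = z₀; rwa [Complex.eta]
  · intro t ht; have h := P.right_inv (hmem t ht); rwa [hPφ] at h
  · intro z hz hre
    have hz' : z ∈ P.source := hball₁ (Metric.ball_subset_ball (min_le_right _ _) hz)
    have hdist : dist (φ z) (φ z₀) < ρ := hδρ (lt_of_lt_of_le (Metric.mem_ball.mp hz) (min_le_left _ _))
    refine ⟨?_, ?_⟩
    · calc |(φ z).im - (φ z₀).im| = |(φ z - φ z₀).im| := by rw [Complex.sub_im]
        _ ≤ ‖φ z - φ z₀‖ := Complex.abs_im_le_norm _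
        _ = dist (φ z) (φ z₀) := (dist_eq_norm _ _).symm
        _ < ρ := hdist
    · have h1 : (⟨(φ z₀).re, (φ z).im⟩ : ℂ) = φ z := Complex.ext (by simp [hre]) (by simp)
      have h := P.left_inv hz'; rw [hPφ] at h; show P.symm ⟨(φ z₀).re, (φ z).im⟩ = z; rwa [h1]

end RhW08.Lens1MeridianLocal
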